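import Mathlib
import HarnessLib
import Summits.AtomisticToContinuum.FouriersLaw.Theses.TangentFlowDephasing

/-!
# `TangentFlowDephasing.TargetGlue` — proved

Item `stmt-AtomisticToContinuum-14118` (support, route `TangentFlowDephasing`, sub-problem `FouriersLaw`):
`OnePhononL2Decay → LifetimeControlsCurrent → NoSelfLocalization → SelfDephasedGreenKubo`.

Pure logic (the `hGKT` block of the route's deciding theorem `closes`, with the shift-invariance and
one-phonon clauses kept in the witness): fix `ω₂ lam β γ > 0` and `T > 0`; `OnePhononL2Decay` supplies a
shift-invariant DLR Gibbs state `μ` and a `μ`-preserving dynamics `D` with absolutely convergent current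
correlations, integrable one-phonon integrands, the `L²`-lifetime clause and the summability clause;
`LifetimeControlsCurrent` applied to this pair gives `C_T ∈ L¹(0,∞)`; `NoSelfLocalization` gives
`0 < κ_GK`; and `HasGreenKubo` is by definition the conjunction of absolute convergence, `C_T ∈ L¹(0,∞)`
and `0 < κ_GK` (`Literature.MathematicalPhysics.KineticTheory.HeatConduction.InfiniteChainDynamics.HasGreenKubo`).
-/

namespace Summit.AtomisticToContinuum.FouriersLaw.Theorems

/-- The target glue of route `TangentFlowDephasing`:
`OnePhononL2Decay → LifetimeControlsCurrent → NoSelfLocalization → SelfDephasedGreenKubo`.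
The `OnePhononL2Decay` witness `(μ, D)` is fed to `LifetimeControlsCurrent` (giving `C_T ∈ L¹(0,∞)`)
and then to `NoSelfLocalization` (giving `0 < κ_GK`); `HasGreenKubo` is the resulting triple. -/
theorem targetGlue_proof :
    Summit.AtomisticToContinuum.FouriersLaw.Theses.TangentFlowDephasing.TargetGlue := by
  unfold Summit.AtomisticToContinuum.FouriersLaw.Theses.TangentFlowDephasing.TargetGlue
  intro h1 h2 h3 ω₂ lam β γ hω hl hβ hγ T hT
  obtain ⟨μ, hG, hS, D, hP, hA, hI, hL, hSum⟩ := h1 ω₂ lam β γ hω hl hβ hγ T hT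
  have hC := h2 ω₂ lam β γ hω hl hβ hγ T hT μ D hG hS hP hA ⟨hI, hL, hSum⟩
  have hpos := h3 ω₂ lam β γ hω hl hβ hγ T hT μ D hG hS hP hA hC
  exact ⟨μ, hG, hS, D, hP, ⟨hA, hI, hL, hSum⟩, hA, hC, hpos⟩

end Summit.AtomisticToContinuum.FouriersLaw.Theorems
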